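import Literature.Probability.RandomPlanarGeometry.SLEHullBoundaryAreaLargeKappa
import Literature.Probability.RandomPlanarGeometry.SLETransienceProofs
import Literature.Probability.RandomPlanarGeometry.SLETransienceEntailsTrace
import HarnessLib

/-!
# Existence of the chordal SLE_κ random curve from the two trace-existence inputs

Topic `Probability/RandomPlanarGeometry`; theorems only, nothing is redefined and no named fact is
introduced. Bookkeeping on the named fact
`Literature.Probability.RandomPlanarGeometry.exists_isSLECurve` (`SLE.lean`: for every `κ > 0` and
every Dobrushin domain `(D; a, b)` there is a random curve `Γ` with `IsSLECurve κ D Γ` — almost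
surely the Loewner chain of `√κ B` is generated by its trace and `Γ` is the class of the
time-compactified image of the trace under the boundary extension of a chordal uniformizing map
`ℍₒ → D`, ending at `b`).

The tree proves `exists_isSLECurve ↔ tendsto_norm_sleTrace_atTop`
(`tendsto_norm_sleTrace_atTop_iff_exists_isSLECurve`, `SLETransienceEntailsTrace`: the Riemann
mapping theorem, Carathéodory's theorem, the measurability of the trace and the zero–one/scaling
reductions of Rohde–Schramm's §7 are theorems), and it proves every step of Rohde–Schramm's §7
below the two inputs through which the SLE trace exists at all:

* `RohdeSchramm2005_cor35 preWienerMeasure` — Rohde–Schramm's one-point derivative estimate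
  Cor. 3.5 (arXiv version: Corollary 7, §3.2), whence Thm. 3.6, whence (with the proved
  deterministic criterion Thm. 4.1) Thm. 5.1 "Let `κ ≠ 8`. … `γ` is a continuous path, and `Hₜ` is
  the unbounded component of `ℍ ∖ γ([0, t])`" (`hasSLETrace_of_ne_eight_of_cor35`), and also the
  grid bound (5.4) behind the null area of `∂Kₜ` for `κ ≥ 8` (`ae_volume_frontier_sleHull_eq_zero_of_cor35`);
* `hasSLETrace_eight` — Lawler–Schramm–Werner (2004), Thm. 4.7: SLE₈ is generated by a curve
  (Rohde–Schramm's Update to Thm. 5.1: "This extension to `κ = 8` is proved in [LSW]").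

This file records the resulting reductions of `exists_isSLECurve`, one `κ` at a time:

* `ae_tendsto_norm_sleTrace_atTop_of_cor35_of_hasSLETrace` — **given Cor. 3.5, for every `κ > 0`,
  if SLE_κ is generated by a curve then its trace is a.s. transient** (Thm. 7.1 with the Update, per
  `κ`: `κ < 8`, `κ ≠ 4` by `tendsto_norm_sleTrace_atTop_of_cor35_of_lt_eight`; `κ = 4` by the proved
  simple-path step `RohdeSchramm2005_thm71_simpleStep_holds` and the scaling/zero–one reduction
  `tendsto_norm_sleTrace_atTop_of_notMem_closure`; `κ ≥ 8` — including `κ = 8` — by the null area of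
  the hull boundary, `tendsto_norm_sleTrace_atTop_of_frontier_null`); so, given Cor. 3.5, a.s.
  transience at `κ` is *equivalent* to `HasSLETrace κ`
  (`ae_tendsto_norm_sleTrace_atTop_iff_hasSLETrace_of_cor35`);
* `exists_isSLECurve_at_of_cor35_of_hasSLETrace` and
  `forall_exists_isSLECurve_iff_hasSLETrace_of_cor35` — **given Cor. 3.5, the chordal SLE_κ curve
  exists in every Dobrushin domain iff the chain of `√κ B` is a.s. generated by a curve**;
* `exists_isSLECurve_at_of_cor35` — hence **for `κ > 0`, `κ ≠ 8`, the chordal SLE_κ curve exists in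
  every Dobrushin domain from Cor. 3.5 alone** (the form the dependents at `κ = 6`, `8/3`, `2`, `3`,
  `4`, `16/3` need; Lawler–Schramm–Werner's SLE₈ theorem is not involved), and
  `exists_isSLECurve_eight_of_cor35_of_hasSLETrace_eight` at `κ = 8`;
* `exists_isSLECurve_of_cor35_of_hasSLETrace_eight` — the named fact from the two inputs — and
  `exists_isSLECurve_iff_hasSLETrace_eight_of_cor35`: **given Cor. 3.5, `exists_isSLECurve` is
  equivalent to the SLE₈ trace theorem `hasSLETrace_eight`**, indeed
  (`exists_isSLECurve_iff_exists_eight_of_cor35`) to the existence of the chordal SLE₈ curve in a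
  single Dobrushin domain.

So the named fact `exists_isSLECurve` rests on exactly the two named facts `RohdeSchramm2005_cor35`
and `hasSLETrace_eight`, and conversely entails the second (`hasSLETrace_eight_of_exists_isSLECurve`,
`SLEExistenceConverse`).

## References

* S. Rohde, O. Schramm, *Basic properties of SLE*, Ann. of Math. 161 (2005) 883–924
  (arXiv:math/0106036): Cor. 3.5 (arXiv Cor. 7, §3.2), Thm. 5.1 (arXiv Thm. 10, §5), Thm. 7.1
  (arXiv Thm. 20, §7) and its proof (p. 911), Update to §1 and §5 (`κ = 8` from [LSW]).
* G. F. Lawler, O. Schramm, W. Werner, *Conformal invariance of planar loop-erased random walks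
  and uniform spanning trees*, Ann. Probab. 32 (2004) 939–995, Thm. 4.7.
* G. F. Lawler, *Conformally Invariant Processes in the Plane*, AMS (2005), §6.3.
-/

noncomputable section

open Filter MeasureTheory
open scoped NNReal

namespace Literature.Probability.RandomPlanarGeometry

variable {κ : ℝ≥0}

/-! ### Transience from Cor. 3.5, one `κ` at a time -/

/-- **Given Rohde–Schramm's Cor. 3.5: for every `κ > 0`, if SLE_κ is generated by a curve then
a.s. `|γ(t)| → ∞`** (Thm. 7.1 with the Update, per `κ`). For `κ < 8`, `κ ≠ 4`:
`tendsto_norm_sleTrace_atTop_of_cor35_of_lt_eight` (Lemma 7.2 by the Koebe route for `κ < 4`,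
Lemma 7.3 for `4 < κ < 8`); at `κ = 4`: the simple-path step of p. 911
(`RohdeSchramm2005_thm71_simpleStep_holds`) and the scaling/zero–one reduction
(`tendsto_norm_sleTrace_atTop_of_notMem_closure`, scale invariance in law
`identDistrib_sleTrace_scale_of_hasSLETrace`); for `κ ≥ 8`: the boundary of the hull is
Lebesgue-null from Cor. 3.5 (`ae_volume_frontier_sleHull_eq_zero_of_cor35`, Cor. 5.3) and
`tendsto_norm_sleTrace_atTop_of_frontier_null`. The hypothesis `HasSLETrace κ` is automatic for
`κ ≠ 8` (`hasSLETrace_of_ne_eight_of_cor35`) and is Lawler–Schramm–Werner's Thm. 4.7 at `κ = 8`.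
[cite: RohdeSchramm2005, Thm 7.1 and Update (p. 911)] -/
theorem ae_tendsto_norm_sleTrace_atTop_of_cor35_of_hasSLETrace
    (h35 : RohdeSchramm2005_cor35 Process.preWienerMeasure) (hκ0 : 0 < κ) (h0 : HasSLETrace κ) :
    ∀ᵐ ω ∂Process.preWienerMeasure, Tendsto (fun t ↦ ‖sleTrace κ ω t‖) atTop atTop := by
  rcases lt_or_ge κ 8 with hlt | hge
  · rcases eq_or_ne κ 4 with rfl | hκ4
    · exact tendsto_norm_sleTrace_atTop_of_notMem_closure h0
        (fun hc ↦ identDistrib_sleTrace_scale_of_hasSLETrace h0 hc)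
        (RohdeSchramm2005_thm71_simpleStep_holds le_rfl h0)
    · exact tendsto_norm_sleTrace_atTop_of_cor35_of_lt_eight h35 hκ0 hκ4 hlt
  · exact tendsto_norm_sleTrace_atTop_of_frontier_null h0 hge
      fun t ↦ ae_volume_frontier_sleHull_eq_zero_of_cor35 h35 hge h0 t

/-- **Given Cor. 3.5, a.s. transience of `sleTrace κ` (`κ > 0`) is equivalent to `HasSLETrace κ`.**
`←` is `ae_tendsto_norm_sleTrace_atTop_of_cor35_of_hasSLETrace`; `→` holds outright
(`hasSLETrace_of_ae_tendsto_norm_sleTrace_atTop`: the junk trace of a chain not generated by a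
curve is constant, hence not transient). [cite: RohdeSchramm2005, Thm 7.1 and Thm 5.1] -/
theorem ae_tendsto_norm_sleTrace_atTop_iff_hasSLETrace_of_cor35
    (h35 : RohdeSchramm2005_cor35 Process.preWienerMeasure) (hκ0 : 0 < κ) :
    (∀ᵐ ω ∂Process.preWienerMeasure, Tendsto (fun t ↦ ‖sleTrace κ ω t‖) atTop atTop) ↔
      HasSLETrace κ :=
  ⟨hasSLETrace_of_ae_tendsto_norm_sleTrace_atTop,
    ae_tendsto_norm_sleTrace_atTop_of_cor35_of_hasSLETrace h35 hκ0⟩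

/-! ### Existence of the chordal SLE_κ curve, one `κ` at a time -/

/-- **Given Cor. 3.5: if SLE_κ (`κ > 0`) is generated by a curve, the chordal SLE_κ curve exists in
every Dobrushin domain** — transience by `ae_tendsto_norm_sleTrace_atTop_of_cor35_of_hasSLETrace`,
conformal transport to `(D; a, b)` by `exists_isSLECurve_at` (Riemann mapping, Carathéodory,
measurability of the trace: proved). [cite: RohdeSchramm2005, Thm 5.1 and Thm 7.1] -/
theorem exists_isSLECurve_at_of_cor35_of_hasSLETrace
    (h35 : RohdeSchramm2005_cor35 Process.preWienerMeasure) (hκ0 : 0 < κ) (h0 : HasSLETrace κ)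
    (D : DobrushinDomain) : ∃ Γ, IsSLECurve κ D Γ :=
  exists_isSLECurve_at h0 (ae_tendsto_norm_sleTrace_atTop_of_cor35_of_hasSLETrace h35 hκ0 h0) D

/-- **Given Cor. 3.5, for `κ > 0`: the chordal SLE_κ curve exists in every Dobrushin domain iff
the Loewner chain of `√κ B` is a.s. generated by a curve.** `→`: an SLE_κ random curve (in any
Dobrushin domain, e.g. the unit disc) witnesses `HasSLETrace κ` (`IsSLECurve.hasSLETrace`); `←`:
`exists_isSLECurve_at_of_cor35_of_hasSLETrace`. [cite: RohdeSchramm2005, Thm 5.1 and Thm 7.1] -/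
theorem forall_exists_isSLECurve_iff_hasSLETrace_of_cor35
    (h35 : RohdeSchramm2005_cor35 Process.preWienerMeasure) (hκ0 : 0 < κ) :
    (∀ D : DobrushinDomain, ∃ Γ, IsSLECurve κ D Γ) ↔ HasSLETrace κ := by
  refine ⟨fun h ↦ ?_, fun h0 D ↦ exists_isSLECurve_at_of_cor35_of_hasSLETrace h35 hκ0 h0 D⟩
  obtain ⟨Γ, hΓ⟩ := h DobrushinDomain.unitDisc
  exact hΓ.hasSLETrace

/-- **The chordal SLE_κ curve, `κ > 0`, `κ ≠ 8`, exists in every Dobrushin domain from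
Rohde–Schramm's Cor. 3.5 alone**: generation by a curve is Thm. 5.1 from Cor. 3.5
(`hasSLETrace_of_ne_eight_of_cor35`); the rest is `exists_isSLECurve_at_of_cor35_of_hasSLETrace`.
Lawler–Schramm–Werner's SLE₈ theorem is not involved. [cite: RohdeSchramm2005, Thm 5.1 and Thm 7.1] -/
theorem exists_isSLECurve_at_of_cor35 (h35 : RohdeSchramm2005_cor35 Process.preWienerMeasure)
    (hκ0 : 0 < κ) (hκ8 : κ ≠ 8) (D : DobrushinDomain) : ∃ Γ, IsSLECurve κ D Γ :=
  exists_isSLECurve_at_of_cor35_of_hasSLETrace h35 hκ0 (hasSLETrace_of_ne_eight_of_cor35 h35 hκ8) D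

/-- **The chordal SLE₈ curve exists in every Dobrushin domain from Cor. 3.5 and
Lawler–Schramm–Werner's Thm. 4.7** (`hasSLETrace_eight`); transience at `κ = 8` is Rohde–Schramm's
Update to Thm. 7.1, obtained from Cor. 3.5 through the null area of the hull boundary.
[cite: RohdeSchramm2005, Thm 7.1 and Update (p. 911); LawlerSchrammWerner2004, Thm 4.7] -/
theorem exists_isSLECurve_eight_of_cor35_of_hasSLETrace_eight
    (h35 : RohdeSchramm2005_cor35 Process.preWienerMeasure) (h8e : hasSLETrace_eight)
    (D : DobrushinDomain) : ∃ Γ, IsSLECurve 8 D Γ :=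
  exists_isSLECurve_at_of_cor35_of_hasSLETrace h35 (by norm_num) h8e D

/-! ### The named fact from the two inputs -/

/-- **`exists_isSLECurve` from the two trace-existence inputs**: Rohde–Schramm's Cor. 3.5
(`RohdeSchramm2005_cor35`, whence Thm. 5.1 for `κ ≠ 8` and Thm. 7.1 for every `κ`) and
Lawler–Schramm–Werner's Thm. 4.7 (`hasSLETrace_eight`). Everything else — Riemann mapping,
Carathéodory, the Loewner theory, the measurability of the trace, §7 of Rohde–Schramm — is proved
in the tree. [cite: RohdeSchramm2005, Thm 5.1 and Thm 7.1; LawlerSchrammWerner2004, Thm 4.7] -/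
theorem exists_isSLECurve_of_cor35_of_hasSLETrace_eight
    (h35 : RohdeSchramm2005_cor35 Process.preWienerMeasure) (h8e : hasSLETrace_eight) :
    exists_isSLECurve := by
  intro κ hκ0 D
  rcases eq_or_ne κ 8 with rfl | hκ8
  · exact exists_isSLECurve_eight_of_cor35_of_hasSLETrace_eight h35 h8e D
  · exact exists_isSLECurve_at_of_cor35 h35 hκ0 hκ8 D

/-- **Given Cor. 3.5, `exists_isSLECurve` is equivalent to the SLE₈ trace theorem**
`hasSLETrace_eight` (Lawler–Schramm–Werner (2004), Thm. 4.7): `←` is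
`exists_isSLECurve_of_cor35_of_hasSLETrace_eight`; `→` holds outright
(`hasSLETrace_eight_of_exists_isSLECurve`: an SLE₈ random curve in the unit disc witnesses that the
chain of `√8 B` is a.s. generated by its trace). [cite: RohdeSchramm2005, Thm 5.1 and Update] -/
theorem exists_isSLECurve_iff_hasSLETrace_eight_of_cor35
    (h35 : RohdeSchramm2005_cor35 Process.preWienerMeasure) :
    exists_isSLECurve ↔ hasSLETrace_eight :=
  ⟨hasSLETrace_eight_of_exists_isSLECurve, exists_isSLECurve_of_cor35_of_hasSLETrace_eight h35⟩

/-- **Given Cor. 3.5, `exists_isSLECurve` is equivalent to `HasSLETrace κ` for every `κ > 0`**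
(of which only `κ = 8` is not supplied by Cor. 3.5 itself).
[cite: RohdeSchramm2005, Thm 5.1 and Update] -/
theorem exists_isSLECurve_iff_forall_hasSLETrace_of_cor35
    (h35 : RohdeSchramm2005_cor35 Process.preWienerMeasure) :
    exists_isSLECurve ↔ ∀ κ : ℝ≥0, 0 < κ → HasSLETrace κ :=
  ⟨fun h _ hκ ↦ hasSLETrace_of_exists_isSLECurve h hκ,
    fun h ↦ exists_isSLECurve_of_cor35_of_hasSLETrace_eight h35 (h 8 (by norm_num))⟩

/-- **Given Cor. 3.5, `exists_isSLECurve` is equivalent to the existence of the chordal SLE₈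
curve in one (any) Dobrushin domain `D₀`**: such a curve witnesses `HasSLETrace 8`
(`IsSLECurve.hasSLETrace`), which is `hasSLETrace_eight`. [cite: RohdeSchramm2005, Thm 5.1 and Update] -/
theorem exists_isSLECurve_iff_exists_eight_of_cor35
    (h35 : RohdeSchramm2005_cor35 Process.preWienerMeasure) (D₀ : DobrushinDomain) :
    exists_isSLECurve ↔ ∃ Γ, IsSLECurve 8 D₀ Γ :=
  ⟨fun h ↦ h (by norm_num) D₀,
    fun ⟨_, hΓ⟩ ↦ exists_isSLECurve_of_cor35_of_hasSLETrace_eight h35 hΓ.hasSLETrace⟩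

end Literature.Probability.RandomPlanarGeometry

end
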